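import Summits.CriticalPhenomena.PercolationContinuityZ3.Theorems.SahiMasterFamilyOrShapeSq

/-!
# The OR-shape at every order, V-a: order in the cone `𝒫` of the square-free algebra; strict positivity of the coefficients

Unit `prim-master-conj` (crux anchor stmt-CriticalPhenomena-4575, helper work), gen 17; memo
`run/shared/lean/prim/prim-l12/prim-master-conj/POINTWISE.md` §18.  Generic square-free lemmas for the zero-locus analysis of the OR-shape
identity (`…OrShapeZero`): comparison `b − a ∈ 𝒫`, monotonicity of products, `(1−u)⁻¹ ≥ u^i`, `((1−u)⁻¹)^k ≥ u^i`, `(1−u)^{−c} − 1 ∈ 𝒫` and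
`(1−u)^{−c} ≥` each term of its series (`c ≥ 0`), the binomial remainder `Δ = 1 − s r − (1−r)^s` vanishes when `r² = 0` and dominates each of
its terms, and STRICT positivity: `(−1)^k C(−c,k) > 0` (`c > 0`), `ψ_k(s) = (−1)^{k+1}k!C(s,k) > 0` (`0 < s < 1`, `k ≥ 1`).
[folklore; cf. Sahi2008, proof of Lemma 16]  Axioms standard.
-/

set_option autoImplicit false

open Finset

open private SqFree.ext coeff_add coeff_sub coeff_one coeff_mul coeff_sum coeff_single coeff_C_mul coeff_C coeff_neg
  isNil_single isNil_lin IsNil.add IsNil.sub IsNil.mul_left IsNil.neg IsNil.sum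
  binomB_zero_right C_mul_single single_mul_single_self single_mul_single_of_disjoint rch_one rch_zero rch_succ_real
  from Literature.Combinatorics.Sahi2008.CumulationCone

open private coeff_lin_pow from Literature.Combinatorics.Sahi2008.FKGCumulation

noncomputable section

open scoped Classical

namespace Summit.CriticalPhenomena.PercolationContinuityZ3.Theorems

namespace OrShape

open Function
open Literature.Combinatorics.Sahi2008
open Literature.Combinatorics.Sahi2008.SqFree
open Literature.Probability.Percolation.DecisionTree (ind ind_of_mem ind_of_not_mem ind_nonneg)

/-! ### Order in the cone `𝒫` -/

section Order

variable {κ : Type*} [DecidableEq κ]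

omit [DecidableEq κ] in
/-- Coefficient comparison from `b − a ∈ 𝒫`. [folklore] -/
theorem coeff_le_of_nonneg_sub {a b : SqFree κ ℝ} (h : (b - a).Nonneg) (τ : Finset κ) : a.coeff τ ≤ b.coeff τ := by
  have := h τ; rw [coeff_sub] at this; linarith

omit [DecidableEq κ] in
/-- `b − a ∈ 𝒫` and `c − b ∈ 𝒫` give `c − a ∈ 𝒫`. [folklore] -/
theorem nonneg_sub_trans {a b c : SqFree κ ℝ} (h1 : (b - a).Nonneg) (h2 : (c - b).Nonneg) : (c - a).Nonneg := fun τ => by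
  have e : c - a = (c - b) + (b - a) := by ring
  rw [e, coeff_add]; exact add_nonneg (h2 τ) (h1 τ)

/-- **Products are monotone in `𝒫`**: `a' ≤ a`, `b' ≤ b` with `a', b ∈ 𝒫` give `a'b' ≤ ab`. [folklore] -/
theorem nonneg_mul_sub_mul {a a' b b' : SqFree κ ℝ} (ha : (a - a').Nonneg) (hb : (b - b').Nonneg) (ha' : a'.Nonneg) (hb0 : b.Nonneg) :
    (a * b - a' * b').Nonneg := by
  have e : a * b - a' * b' = (a - a') * b + a' * (b - b') := by ring
  rw [e]
  exact fun τ => by rw [coeff_add]; exact add_nonneg (nonneg_mul ha hb0 τ) (nonneg_mul ha' hb τ)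

/-- Dropping all monomials but one: `u − (u_τ)·x^τ ∈ 𝒫` for `u ∈ 𝒫`. [folklore] -/
theorem nonneg_sub_single_coeff {u : SqFree κ ℝ} (hu : u.Nonneg) (τ : Finset κ) : (u - single τ (u.coeff τ)).Nonneg := fun ρ => by
  rw [coeff_sub, coeff_single]
  split_ifs with h
  · subst h; simp
  · rw [sub_zero]; exact hu ρ

/-- Dropping terms of a sum of elements of `𝒫`. [folklore] -/
theorem nonneg_sum_sub_term {β : Type*} {s : Finset β} {g : β → SqFree κ ℝ} (h : ∀ x ∈ s, (g x).Nonneg) {x : β} (hx : x ∈ s) :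
    ((∑ y ∈ s, g y) - g x).Nonneg := by
  rw [← Finset.add_sum_erase s g hx, add_sub_cancel_left]
  exact nonneg_sum fun y hy => h y (Finset.mem_of_mem_erase hy)

/-- `(1 + a)^k − 1 ∈ 𝒫` for `a ∈ 𝒫`. [folklore] -/
theorem nonneg_one_add_pow_sub_one {a : SqFree κ ℝ} (ha : a.Nonneg) : ∀ k : ℕ, ((1 + a) ^ k - 1).Nonneg
  | 0 => by rw [pow_zero, sub_self]; exact fun _ => le_rfl
  | k + 1 => by
    have e : (1 + a) ^ (k + 1) - 1 = (1 + a) * ((1 + a) ^ k - 1) + a := by ring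
    rw [e]
    exact fun τ => by
      rw [coeff_add]
      exact add_nonneg (nonneg_mul (fun ρ => by rw [coeff_add]; exact add_nonneg (nonneg_one ρ) (ha ρ))
        (nonneg_one_add_pow_sub_one ha k) τ) (ha τ)

/-- A product of factors `f_x` with `f_x ∈ 𝒫`, `f_x − 1 ∈ 𝒫` dominates `1`. [folklore] -/
theorem nonneg_prod_sub_one {β : Type*} (s : Finset β) {f : β → SqFree κ ℝ} (hf : ∀ x ∈ s, (f x).Nonneg)
    (hf1 : ∀ x ∈ s, (f x - 1).Nonneg) : ((∏ x ∈ s, f x) - 1).Nonneg := by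
  induction s using Finset.cons_induction with
  | empty => rw [Finset.prod_empty, sub_self]; exact fun _ => le_rfl
  | cons x s hx ih =>
    rw [Finset.prod_cons]
    have e : f x * ∏ y ∈ s, f y - 1 = f x * ((∏ y ∈ s, f y) - 1) + (f x - 1) := by ring
    rw [e]
    exact fun τ => by
      rw [coeff_add]
      exact add_nonneg (nonneg_mul (hf x (Finset.mem_cons_self x s))
        (ih (fun y hy => hf y (Finset.mem_cons_of_mem hy)) (fun y hy => hf1 y (Finset.mem_cons_of_mem hy))) τ)
        (hf1 x (Finset.mem_cons_self x s) τ)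

/-- A product of such factors dominates each single factor. [folklore] -/
theorem nonneg_prod_sub_factor {β : Type*} (s : Finset β) {f : β → SqFree κ ℝ} (hf : ∀ x ∈ s, (f x).Nonneg)
    (hf1 : ∀ x ∈ s, (f x - 1).Nonneg) {x : β} (hx : x ∈ s) : ((∏ y ∈ s, f y) - f x).Nonneg := by
  rw [← Finset.mul_prod_erase s f hx]
  have e : f x * ∏ y ∈ s.erase x, f y - f x = f x * ((∏ y ∈ s.erase x, f y) - 1) := by ring
  rw [e]
  exact nonneg_mul (hf x hx) (nonneg_prod_sub_one _ (fun y hy => hf y (Finset.mem_of_mem_erase hy))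
    (fun y hy => hf1 y (Finset.mem_of_mem_erase hy)))

variable [Fintype κ]

/-- `(1−u)⁻¹ − u^i ∈ 𝒫` for `u ∈ 𝒫`, `i ≤ |κ|`. [folklore] -/
theorem nonneg_inv1_sub_pow {u : SqFree κ ℝ} (hu : u.Nonneg) {i : ℕ} (hi : i ≤ Fintype.card κ) : (inv1 u - u ^ i).Nonneg := by
  unfold inv1
  exact nonneg_sum_sub_term (fun j _ => nonneg_pow hu j) (Finset.mem_range.mpr (Nat.lt_succ_of_le hi))

/-- `(1−u)⁻¹ − 1 ∈ 𝒫` for `u ∈ 𝒫`. [folklore] -/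
theorem nonneg_inv1_sub_one {u : SqFree κ ℝ} (hu : u.Nonneg) : (inv1 u - 1).Nonneg := by
  have h := nonneg_inv1_sub_pow hu (Nat.zero_le _) (i := 0)
  rwa [pow_zero] at h

/-- `((1−u)⁻¹)^k − u^i ∈ 𝒫` for `u ∈ 𝒫`, `k ≥ 1`, `i ≤ |κ|`. [folklore] -/
theorem nonneg_inv1_pow_sub_pow {u : SqFree κ ℝ} (hu : u.Nonneg) {k : ℕ} (hk : 1 ≤ k) {i : ℕ} (hi : i ≤ Fintype.card κ) :
    ((inv1 u) ^ k - u ^ i).Nonneg := by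
  obtain ⟨k', rfl⟩ := Nat.exists_eq_add_of_le' hk
  rw [pow_succ']
  have h1 : ((inv1 u) ^ k' - 1).Nonneg := by
    have e : inv1 u = 1 + (inv1 u - 1) := by ring
    rw [e]; exact nonneg_one_add_pow_sub_one (nonneg_inv1_sub_one hu) k'
  have h := nonneg_mul_sub_mul (nonneg_inv1_sub_pow hu hi) h1 (nonneg_pow hu i) (nonneg_pow (nonneg_inv1 hu) k')
  rwa [mul_one] at h

/-- For `c ≥ 0`, `u ∈ 𝒫` nil: `(1−u)^{−c} − 1 ∈ 𝒫`. [cite: Sahi2008, proof of Lemma 16 (p. 224)] -/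
theorem nonneg_binomB_neg_sub_one {c : ℝ} (hc : 0 ≤ c) {u : SqFree κ ℝ} (hu : u.Nonneg) : (binomB (-c) u - 1).Nonneg := by
  rw [binomB, Finset.sum_range_succ', rch_zero, map_one, pow_zero, mul_one, add_sub_cancel_right]
  refine nonneg_sum fun k _ => ?_
  have e : (-u) ^ (k + 1) = C ((-1 : ℝ) ^ (k + 1)) * u ^ (k + 1) := by rw [neg_pow, map_pow, map_neg, map_one]
  rw [e, ← mul_assoc, ← map_mul]
  refine nonneg_mul (nonneg_C ?_) (nonneg_pow hu _)
  rw [mul_comm]; exact neg_one_pow_mul_rch_nonneg_of_nonpos (neg_nonpos.mpr hc) (k + 1)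

/-- For `c ≥ 0`, `u ∈ 𝒫`, `k ≤ |κ|`: `(1−u)^{−c} − (−1)^k C(−c,k)·u^k ∈ 𝒫` (all the other terms of the series are in `𝒫`).
[cite: Sahi2008, proof of Lemma 16 (p. 224)] -/
theorem nonneg_binomB_neg_sub_term {c : ℝ} (hc : 0 ≤ c) {u : SqFree κ ℝ} (hu : u.Nonneg) {k : ℕ} (hk : k ≤ Fintype.card κ) :
    (binomB (-c) u - C ((-1 : ℝ) ^ k * rch k (-c)) * u ^ k).Nonneg := by
  have hterm : ∀ j ∈ range (Fintype.card κ + 1), (C (rch j (-c)) * (-u) ^ j : SqFree κ ℝ).Nonneg := by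
    intro j _
    have e : (-u) ^ j = C ((-1 : ℝ) ^ j) * u ^ j := by rw [neg_pow, map_pow, map_neg, map_one]
    rw [e, ← mul_assoc, ← map_mul]
    refine nonneg_mul (nonneg_C ?_) (nonneg_pow hu _)
    rw [mul_comm]; exact neg_one_pow_mul_rch_nonneg_of_nonpos (neg_nonpos.mpr hc) j
  have h := nonneg_sum_sub_term hterm (Finset.mem_range.mpr (Nat.lt_succ_of_le hk)) (x := k)
  unfold binomB
  have e : (C (rch k (-c)) * (-u) ^ k : SqFree κ ℝ) = C ((-1 : ℝ) ^ k * rch k (-c)) * u ^ k := by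
    rw [neg_pow, map_mul, map_pow, map_neg, map_one]; ring
  rwa [e] at h

end Order

/-! ### Strict positivity of the coefficients -/

section Strict

/-- `(−1)^k C(−c,k) = c(c+1)⋯(c+k−1)/k! > 0` for `c > 0`. [folklore] -/
theorem neg_one_pow_mul_rch_pos_of_neg {c : ℝ} (hc : 0 < c) : ∀ k : ℕ, 0 < (-1 : ℝ) ^ k * rch k (-c)
  | 0 => by rw [rch_zero]; norm_num
  | k + 1 => by
    have ih := neg_one_pow_mul_rch_pos_of_neg hc k
    rw [rch_succ_real]
    have e : (-1 : ℝ) ^ (k + 1) * (rch k (-c) * (-c - (k : ℝ)) / ((k : ℝ) + 1)) =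
        ((-1 : ℝ) ^ k * rch k (-c)) * ((c + k) / ((k : ℝ) + 1)) := by rw [pow_succ]; ring
    rw [e]
    exact mul_pos ih (div_pos (by positivity) (by positivity))

/-- `ψ_k(s) = (−1)^{k+1} k! C(s,k) = s(1−s)⋯(k−1−s) > 0` for `0 < s < 1`, `k ≥ 1`. [folklore] -/
theorem psi_pos {s : ℝ} (h0 : 0 < s) (h1 : s < 1) : ∀ {k : ℕ}, 1 ≤ k → 0 < (-1 : ℝ) ^ (k + 1) * rch k s * (k.factorial : ℝ)
  | 0, hk => absurd hk (by norm_num)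
  | 1, _ => by rw [rch_one]; simpa using h0
  | k + 2, _ => by
    have ih := psi_pos h0 h1 (k := k + 1) (by omega)
    rw [rch_succ_real (k + 1), Nat.factorial_succ (k + 1)]
    push_cast
    have e : (-1 : ℝ) ^ (k + 2 + 1) * (rch (k + 1) s * (s - ((k : ℝ) + 1)) / ((k : ℝ) + 1 + 1)) * (((k : ℝ) + 1 + 1) * ((k + 1).factorial : ℝ)) =
        ((-1 : ℝ) ^ (k + 1 + 1) * rch (k + 1) s * ((k + 1).factorial : ℝ)) * (((k : ℝ) + 1) - s) := by
      have hne : ((k : ℝ) + 1 + 1) ≠ 0 := by positivity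
      field_simp
      ring
    rw [e]
    refine mul_pos ih ?_
    have : (0 : ℝ) ≤ k := Nat.cast_nonneg k
    linarith

end Strict

section Delta

variable {κ : Type*} [DecidableEq κ] [Fintype κ]

/-- If `r² = 0` (and `r` nil) then `(1−r)^s = 1 − s·r`, so `Δ = 1 − s r − (1−r)^s = 0`. [folklore] -/
theorem delta_eq_zero_of_sq (s : ℝ) {r : SqFree κ ℝ} (hr : r.IsNil) (hrr : r * r = 0) : 1 - C s * r - binomB s r = 0 := by
  cases hκ : Fintype.card κ with
  | zero =>
    rw [eq_zero_of_isNil_of_card_eq_zero hκ hr, mul_zero, sub_zero, binomB_zero_right, sub_self]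
  | succ N =>
    rw [binomB, hκ, Finset.sum_range_succ', Finset.sum_range_succ', rch_zero, rch_one, map_one, pow_zero, mul_one, pow_one]
    have hz : ∀ k ∈ range N, (C (rch (k + 1 + 1) s) * (-r) ^ (k + 1 + 1) : SqFree κ ℝ) = 0 := by
      intro k _
      rw [pow_succ, pow_succ, mul_assoc ((-r) ^ k), neg_mul_neg, hrr, mul_zero, mul_zero]
    rw [Finset.sum_eq_zero hz, zero_add, mul_neg]
    ring

/-- Dropping all terms of `Δ = Σ_{k≥2} (−1)^{k+1}C(s,k) r^k` but one: for `0 ≤ s ≤ 1`, `r ∈ 𝒫` nil and `2 ≤ k ≤ |κ|`,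
`Δ − (−1)^{k+1} C(s,k)·r^k ∈ 𝒫`. [folklore] -/
theorem nonneg_delta_sub_term {s : ℝ} (h0 : 0 ≤ s) (h1 : s ≤ 1) {r : SqFree κ ℝ} (hr : r.Nonneg) {k : ℕ} (hk2 : 2 ≤ k)
    (hk : k ≤ Fintype.card κ) : (1 - C s * r - binomB s r - C ((-1 : ℝ) ^ (k + 1) * rch k s) * r ^ k).Nonneg := by
  obtain ⟨N, hN⟩ : ∃ N, Fintype.card κ = N + 1 := ⟨Fintype.card κ - 1, by omega⟩
  rw [binomB_eq_one_sub, hN, Finset.sum_range_succ' _ N]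
  have hT0 : C ((-1 : ℝ) ^ 0 * rch (0 + 1) s) * r ^ (0 + 1) = C s * r := by
    rw [pow_zero, one_mul, zero_add, pow_one, rch_one]
  rw [hT0]
  have e : (1 : SqFree κ ℝ) - C s * r -
      (1 - (∑ j ∈ range N, C ((-1 : ℝ) ^ (j + 1) * rch (j + 1 + 1) s) * r ^ (j + 1 + 1) + C s * r)) -
        C ((-1 : ℝ) ^ (k + 1) * rch k s) * r ^ k =
      ∑ j ∈ range N, C ((-1 : ℝ) ^ (j + 1) * rch (j + 1 + 1) s) * r ^ (j + 1 + 1) - C ((-1 : ℝ) ^ (k + 1) * rch k s) * r ^ k := by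
    ring
  rw [e]
  obtain ⟨j, rfl⟩ := Nat.exists_eq_add_of_le' hk2
  have hterm : ∀ i ∈ range N, (C ((-1 : ℝ) ^ (i + 1) * rch (i + 1 + 1) s) * r ^ (i + 1 + 1) : SqFree κ ℝ).Nonneg :=
    fun i _ => nonneg_mul (nonneg_C (neg_one_pow_mul_rch_succ_nonneg h0 h1 (i + 1))) (nonneg_pow hr _)
  have h := nonneg_sum_sub_term hterm (Finset.mem_range.mpr (show j < N by omega)) (x := j)
  have e2 : (-1 : ℝ) ^ (j + 2 + 1) = (-1) ^ (j + 1) := by rw [pow_succ, pow_succ, pow_succ]; ring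
  rwa [e2]

end Delta

end OrShape
end Summit.CriticalPhenomena.PercolationContinuityZ3.Theorems
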